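import Summits.Langlands.Langlands.Theorems.PicardMuOrdinaryMuOrdinaryFamilyRTThorneCompanionAut
import Summits.Langlands.Langlands.Theorems.PicardMuOrdinaryMuOrdinaryFamilyRTThorneWeightChildA
import HarnessLib

/-!
# Crux `MuOrdinaryFamilyRT` (stmt-Langlands-13757), line `thorne-minimal-lift`: the kernel-checked reductions of
# skeleton v6 over the Thorne-ready companion interface (Reduction file of `…ThorneCompanionAut`, p160433)

Proofs only.  `stub_companionsT_of : MF1ᵃ → MF2 → G1 → T.stub_companionsT` (as the landed `stub_companionsW_of`,
…ThorneWeightReduction p159438, keeping the wall's conclusions (f) `UnramifiedOff` and (g) `Qian2022.IsAutomorphic`);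
`definiteHostPlusT_of : T.stub_finiteOverWeights → T.stub_companionsT → T.stub_thorneLiftT → T.stub_definiteHostPlusW`;
`MuOrdinaryFamilyRT_of_thorneStubsT` (the crux BY NAME from the six v6 stubs `T.stub_minimalFamilyW`, `T.stub_finiteOverWeights`,
`T.stub_companionsT`, `T.stub_thorneLiftT`, `T.stub_remainderPlus`, `T.stub_facts`, through the landed `MuOrdinaryFamilyRT_of_plusW`);
`rtMuOrdinaryMinimal_of_thorneStubsT` (child A of the landed Split, through `rtMuOrdinaryMinimal_of_plusW`, …ThorneWeightChildA
p160178).  `stub_companionsT_of` and `MuOrdinaryFamilyRT_of_thorneStubsT` are registered on the crux item.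
-/

set_option linter.dupNamespace false

namespace Summit.Langlands.Langlands.Cruxes.MuOrdinaryFamilyRT.ThorneMinimalLift

open scoped NumberField Polynomial Matrix Classical
open Field IsDedekindDomain Polynomial
open Literature.NumberTheory.GaloisRepresentations Literature.NumberTheory.Automorphic
open Summit.Langlands.Langlands.Cruxes.MuOrdinaryFamilyRT.CharZeroDominance

noncomputable section

variable {f : ℤ[X]} {ι : PadicAlgCl 3 ≃+* ℂ} {e : K →+* ℂ} {S₀ : Finset (HeightOneSpectrum (𝓞 K))}
  {ρC : FramedGaloisRep K (PadicAlgCl 3) 3}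

/-- **`T.stub_companionsT` from MF1ᵃ + MF2 + G1** (as the landed `stub_companionsW_of`, keeping the two extra conclusions (f)
`UnramifiedOff` and (g) `Qian2022.IsAutomorphic` of the wall for the Thorne-ready interface). -/
theorem stub_companionsT_of : Missing.hidaOrdinaryCompanionsAut → Missing.ordinaryPolarizedSeed → Missing.auxiliaryCMField → T.stub_companionsT := by
  intro hMF1 hMF2 hG1 f ι e S₀ ρC 𝓕 hgen hin hM hdim hpur hfin hW
  obtain ⟨F', iF, iN, iA, iG, iCM, hdeg, hrange, hunr, hsplit⟩ := hG1 f ι e S₀ ρC 𝓕 hgen hin hM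
  have hcpt' : isCompact_glFiniteIntegralLevel 3 F' := isCompact_glFiniteIntegralLevel_holds 3 F'
  obtain ⟨D, E, hE, hint, hacc, hpts⟩ :=
    arithmeticPoints_of_weightDataOver 𝓕 hfin F' (hW F' hdeg hsplit)
  obtain ⟨S', P₀, r₀, hS', hP₀, hirr, hcompat₀, hunr₀, hpol₀, hpur₀, haux₀, hred₀, hord₀⟩ :=
    hMF2 f ι e S₀ ρC 𝓕 hgen hin hM hpur F' hcpt' hdeg hrange hunr hsplit
  refine ⟨F', iF, iN, iA, iG, hcpt', S', D, E, hdeg, iCM, hrange, hE, hS', hint, hacc, ?_⟩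
  intro y hy
  obtain ⟨hcont, hyint, hpolar, wt, hwt⟩ := hpts y hy
  have hdom : ∀ w : HeightOneSpectrum (𝓞 F'), ((3 : ℕ) : 𝓞 F') ∈ w.asIdeal → (wt w).IsDominant :=
    fun w hw => isDominant_of_gaps (wt w) (hwt w hw).1
  have hwit : ∃ ρ : absoluteGaloisGroup F' →* GL (Fin 3) (PadicAlgCl 3), TracePolarizedHom F' 𝓕.m ρ ∧
      ∀ w : HeightOneSpectrum (𝓞 F'), ((3 : ℕ) : 𝓞 F') ∈ w.asIdeal →
        ∀ art : LocalArtinData (w.adicCompletion F'), art.IsCanonical →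
          IsBorelOfWeightAt F' w art ρ (wt w) :=
    ⟨_, hpolar, fun w hw art hart => (hwt w hw).2 art hart⟩
  obtain ⟨P, r, hP, hcompat, hunrr, hpol, hpurr, ⟨g, hcong⟩, hord, haut⟩ :=
    hMF1 F' ι hcpt' S' 𝓕.m hunr hsplit P₀ r₀ hP₀ hirr hcompat₀ hunr₀ hpol₀ hpur₀ haux₀
      (fun σ i j => (hred₀ σ i j).1) hord₀ wt hdom hwit
  refine ⟨P, r, hP, hcompat, hpol, hpurr, hcont, hyint, ⟨g, fun σ i j => ⟨(hcong σ i j).1, ?_⟩⟩, ?_, hunrr, haut⟩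
  · exact norm_sub_lt_one_chain₃ _ _ _ _ (hcong σ i j).2 (hred₀ σ i j).2
      (norm_cast_rbar_sub_pointRep_lt_one 𝓕 y hcont (absGaloisRestrict K F' σ) i j)
  · intro w hw art hart
    refine ⟨wt w, (hwt w hw).1, hord w hw art hart, ?_⟩
    obtain ⟨g', U, hup, hdiag⟩ := (hwt w hw).2 art hart
    exact ⟨g', U, hup, hdiag⟩

/-- **K1⁺ (relativised) from finiteness, Thorne-ready companions and lifting from Thorne-ready companions.** -/
theorem definiteHostPlusT_of :
    T.stub_finiteOverWeights → T.stub_companionsT → T.stub_thorneLiftT → T.stub_definiteHostPlusW := by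
  intro hfin hcomp hlift f ι e S₀ ρC 𝓕 hgen hin hM hdim hpur hΛ hW
  have hfin' : Module.Finite 𝓕.Λ 𝓕.R := hfin f ι e S₀ ρC 𝓕 hgen hin hM hdim hpur hΛ
  refine ⟨hfin', ?_⟩
  obtain ⟨F', instF, instNF, instA, instG, hcpt', S', D, E, hdeg, hCM, hrange, hE, hS', hDint, hDacc, hcompanion⟩ :=
    hcomp f ι e S₀ ρC 𝓕 hgen hin hM hdim hpur hfin' hW
  exact ⟨F', instF, instNF, instA, hcpt', S', D, E, hdeg, hE, hS', hDint, hDacc,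
    fun y hy => hlift f ι e S₀ ρC 𝓕 hgen hin hM hpur F' hcpt' S' hdeg hCM hrange hS' y (hcompanion y hy)⟩

/-- **The crux from the six v6 stubs** (through the landed `MuOrdinaryFamilyRT_of_plusW`). -/
theorem MuOrdinaryFamilyRT_of_thorneStubsT : T.stub_minimalFamilyW → T.stub_finiteOverWeights → T.stub_companionsT → T.stub_thorneLiftT → T.stub_remainderPlus → T.stub_facts → Summit.Langlands.Langlands.Theses.PicardMuOrdinary.MuOrdinaryFamilyRT :=
  fun h₁ h₂ h₃ h₄ h₅ h₆ =>
    crux_iff.mpr <|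
      MuOrdinaryFamilyRT_of_plusW (stub_picardInput_of h₆.1) h₁ (definiteHostPlusT_of h₂ h₃ h₄) stub_accumulation
        (stub_quadraticDescent_of h₆.2.1 h₆.2.2.1
          Literature.NumberTheory.Automorphic.exists_twist_quadraticSign_holds
          h₆.2.2.2.1 h₆.2.2.2.2.1 h₆.2.2.2.2.2)
        stub_dictionary h₅

/-- **Child A of the landed Split from the v6 stubs** (through the landed `rtMuOrdinaryMinimal_of_plusW`). -/
theorem rtMuOrdinaryMinimal_of_thorneStubsT : T.stub_minimalFamilyW → T.stub_finiteOverWeights → T.stub_companionsT → T.stub_thorneLiftT → S.stub_descentFacts → Summit.Langlands.Langlands.Cruxes.MuOrdinaryFamilyRT.Split.RTMuOrdinaryMinimal :=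
  fun h₁ h₂ h₃ h₄ h₆ =>
    rtMuOrdinaryMinimal_of_plusW h₁ (definiteHostPlusT_of h₂ h₃ h₄)
      (stub_quadraticDescent_of h₆.1 h₆.2.1 Literature.NumberTheory.Automorphic.exists_twist_quadraticSign_holds
        h₆.2.2.1 h₆.2.2.2.1 h₆.2.2.2.2)

end

end Summit.Langlands.Langlands.Cruxes.MuOrdinaryFamilyRT.ThorneMinimalLift
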